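import Summits.CriticalPhenomena.CardyFormulaZ2.Theses.CardySelfRefinement
import HarnessLib

/-!
# `LagHandOff` (route `CardySelfRefinement`, stmt-CriticalPhenomena-10268): kill templates —
# one persistent lattice discrepancy plus the antecedents refutes the crux

Standing falsifiers of the adversary (refuter `cdisprove`).  Clause (ii) of the crux hides three
universality statements about bond-`ℤ²` interface limits along the chosen subsequence; each
template turns ONE persistent discrepancy in interface statistics
`∫ f (bondInterfaceIn D (E δ) ·) dPerc` into `¬ LagHandOff`, GIVEN the antecedents
`RotationInput`, `ScaleInvariantLimits` (which a Lean refutation would have to prove — see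
`Negative/Structure.lean`, `not_lagHandOff_iff_clauseII`):

* `not_lagHandOff_of_two_families` — E-blindness: two admissible discretisation families of ONE
  Dobrushin domain must have the same interface limit;
* `not_lagHandOff_of_moved_incoherent` — Euclidean / scale covariance against the UNMOVED
  lattice: `P (φD) = φ_* (P D)` while both sides are limits of interfaces drawn on the same
  lattices `δₙℤ²` (`φ` a rotation by `α ∉ (π/2)ℤ`: interface-level shadow of `RotationInput`;
  `φ` a dilation: a log-periodicity test);
* `eq_of_isLocal_of_carrier_eq`, `not_lagHandOff_of_same_carrier_incoherent` — wiring-orientation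
  blindness: `IsLocal` alone forces `P D = P D'` for two Dobrushin structures on one carrier with
  the same marks (e.g. `unitDisc` and `unitDisc.map conj`, which swap the wired arc).

All three are consistent with an SLE₆ limit (self-duality of bond-`ℤ²` at `p = ½`, reflection
symmetry, the half-mesh shift between primal and dual lattice), so none is a kill today; they are
`o(1)` statements, so a Monte-Carlo run can only show trends.  Work file:
`Cruxes/LagHandOff/Disproof.lean`.
-/

noncomputable section

open MeasureTheory Filter Set Topology
open Literature.Probability.Percolation Literature.Probability.LatticeModels
open Literature.Probability.RandomPlanarGeometry Literature.Probability.Percolation.QuadCrossing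
open Summit.CriticalPhenomena.CardyFormulaZ2.Theses.CardySelfRefinement

namespace Summit.CriticalPhenomena.CardyFormulaZ2.Theorems.LagHandOff.Negative

/-! ### Kill templates: one persistent lattice discrepancy + the antecedents ⇒ `¬ LagHandOff` -/

/-- **TEMPLATE 1 — hidden `E`-universality.**  Clause (ii) makes the interface limit along the
chosen subsequence the SAME for every admissible discretisation family of a given Dobrushin domain;
so, given the antecedents, two admissible families `E`, `E'` of one `D` whose `f`-statistics stay
apart along every subsequence of some mesh sequence refute the crux. [folklore] -/
theorem not_lagHandOff_of_two_families (hR : RotationInput) (hS : ScaleInvariantLimits)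
    (D : DobrushinDomain) (E E' : ℝ → DiscreteDobrushin)
    (hE : ZdDiscretisationFamily D E) (hE' : ZdDiscretisationFamily D E')
    (f : BoundedContinuousFunction (CurveClass ℂ) ℝ) (δs : ℕ → ℝ) (hpos : ∀ n, 0 < δs n)
    (hlim : Tendsto δs atTop (𝓝 0))
    (h : ∀ φ : ℕ → ℕ, StrictMono φ →
      ¬ Tendsto (fun n =>
          (∫ ω, f (bondInterfaceIn D (E (δs (φ n))) ω) ∂(bondPercolation (zdGraph 2) half)) -
            ∫ ω, f (bondInterfaceIn D (E' (δs (φ n))) ω) ∂(bondPercolation (zdGraph 2) half))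
        atTop (𝓝 0)) :
    ¬ LagHandOff := by
  intro hL
  obtain ⟨φ, hφ, P, -, -, hconv⟩ := (hL hR hS).2 δs hpos hlim
  have h12 := (hconv D E hE f).sub (hconv D E' hE' f)
  rw [sub_self] at h12
  exact h φ hφ h12

/-- **TEMPLATE 2 — Euclidean / scale covariance against the UNMOVED lattice.**  Clause (ii)
asserts, along one subsequence, `P (φD) = φ_* (P D)` for every similarity `φ = (z ↦ c z + w)` while
BOTH sides are limits of interfaces drawn on the same lattices `δₙℤ²`.  So, given the antecedents,
a domain `D`, admissible families `E` of `D` and `E'` of `φD`, and a test function `f` whose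
statistics `∫ f (γ^{φD,E'})` and `∫ (f ∘ φ) (γ^{D,E})` stay apart along every subsequence refute
the crux.  (`c = e^{iα}`, `α ∉ (π/2)ℤ`: the interface-level shadow of `RotationInput`; `c = t > 0`:
that of `ScaleInvariantLimits`, a log-periodicity test of ONE family at meshes `δ`, `δ/t`.) [folklore] -/
theorem not_lagHandOff_of_moved_incoherent (hR : RotationInput) (hS : ScaleInvariantLimits)
    (D : DobrushinDomain) (c : ℂ) (hc : c ≠ 0) (w : ℂ)
    (E : ℝ → DiscreteDobrushin) (hE : ZdDiscretisationFamily D E)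
    (E' : ℝ → DiscreteDobrushin) (hE' : ZdDiscretisationFamily (D.map (similarity c hc w)) E')
    (f : BoundedContinuousFunction (CurveClass ℂ) ℝ) (δs : ℕ → ℝ) (hpos : ∀ n, 0 < δs n)
    (hlim : Tendsto δs atTop (𝓝 0))
    (h : ∀ φ : ℕ → ℕ, StrictMono φ →
      ¬ Tendsto (fun n =>
          (∫ ω, f (bondInterfaceIn (D.map (similarity c hc w)) (E' (δs (φ n))) ω)
              ∂(bondPercolation (zdGraph 2) half)) -
            ∫ ω, f ((bondInterfaceIn D (E (δs (φ n))) ω).map (similarity c hc w : C(ℂ, ℂ)))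
              ∂(bondPercolation (zdGraph 2) half))
        atTop (𝓝 0)) :
    ¬ LagHandOff := by
  intro hL
  obtain ⟨φ, hφ, P, hP, -, hconv⟩ := (hL hR hS).2 δs hpos hlim
  -- the moved test function `f ∘ (map φ)`, bounded continuous
  let g : BoundedContinuousFunction (CurveClass ℂ) ℝ :=
    f.compContinuous ⟨CurveClass.map (similarity c hc w : C(ℂ, ℂ)),
      (CurveClass.lipschitzWith_map (lipschitzWith_similarity c hc w)).continuous⟩
  have hg : ∀ γ, g γ = f (γ.map (similarity c hc w : C(ℂ, ℂ))) := fun γ => rfl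
  have h1 := hconv (D.map (similarity c hc w)) E' hE' f
  have h2 := hconv D E hE g
  have hcov : P (D.map (similarity c hc w)) =
      (P D).map (CurveClass.map (similarity c hc w : C(ℂ, ℂ))) :=
    hP.similarity D c hc w
  have hint : ∫ γ, f γ ∂(P (D.map (similarity c hc w))) = ∫ γ, g γ ∂(P D) := by
    rw [hcov, integral_map (measurable_curveClassMap_similarity c hc w).aemeasurable
      f.continuous.aestronglyMeasurable]
    rfl
  rw [hint] at h1
  have h12 := h1.sub h2
  rw [sub_self] at h12
  exact h φ hφ h12

/-- **The carrier identity behind TEMPLATE 3**, from `IsLocal` alone: two Dobrushin domains with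
the same carrier and the same marked points receive the same law from every LOCAL family (the
stopping set `closure (D ∖ D') = ∅` stops nothing).  In particular an admissible `P` is blind to
the boundary parametrisation — to WHICH arc is wired. (Also landed for crux 0698 as
`CardyRotToConfR2SymmetryUpgrade.Negative.eq_of_isLocal_of_carrier_eq`.) [folklore] -/
theorem eq_of_isLocal_of_carrier_eq {P : ChordalFamily} (hP : P.IsLocal) {D D' : DobrushinDomain}
    (hc : D'.carrier = D.carrier) (h0 : D'.pt 0 = D.pt 0) (h1 : D'.pt 1 = D.pt 1) :
    P D' = P D := by
  have hempty : closure (D.carrier \ D'.carrier) = ∅ := by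
    rw [hc, sdiff_self]
    exact closure_empty
  have key : ∀ c' : Curve ℂ, c'.stopAt (∅ : Set ℂ) = c' := by
    intro c'
    have hparam : c'.hitParam (∅ : Set ℂ) = 1 := by
      apply le_antisymm (c'.hitParam_mem_Icc ∅).2
      apply le_csInf ⟨1, c'.one_mem_hitSet ∅⟩
      rintro t (⟨_h, ht⟩ | ht)
      · exact absurd ht (Set.notMem_empty _)
      · rw [Set.mem_singleton_iff.1 ht]
    refine Curve.ext (ContinuousMap.ext fun s => ?_)
    change (c'.stopAt ∅) s = c' s
    rw [Curve.stopAt_apply, hparam, one_mul, Set.projIcc_val]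
  have hstop : ∀ γ : CurveClass ℂ, γ.stopAt (∅ : Set ℂ) = γ := by
    intro γ
    change CurveClass.mk (γ.out.stopAt ∅) = γ
    rw [key, CurveClass.mk_out]
  have hid : (fun γ : CurveClass ℂ => γ.stopAt (closure (D.carrier \ D'.carrier))) = id := by
    funext γ; rw [hempty]; exact hstop γ
  ext T hT
  have := hP D D' hc.le h0 h1 T hT
  simpa [hid] using this

/-- **TEMPLATE 3 — wiring-orientation blindness.**  By `eq_of_isLocal_of_carrier_eq` the witness
`P` of (ii) gives the same law to two Dobrushin structures `D`, `D'` on ONE carrier with the same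
marks — e.g. opposite boundary orientations, which SWAP the wired arc (`unitDisc` versus
`unitDisc.map conj`).  So, given the antecedents, admissible families of `D` and of `D'` whose
interface statistics stay apart along every subsequence refute the crux. [folklore] -/
theorem not_lagHandOff_of_same_carrier_incoherent (hR : RotationInput) (hS : ScaleInvariantLimits)
    (D D' : DobrushinDomain) (hc : D'.carrier = D.carrier) (h0 : D'.pt 0 = D.pt 0)
    (h1 : D'.pt 1 = D.pt 1)
    (E : ℝ → DiscreteDobrushin) (hE : ZdDiscretisationFamily D E)
    (E' : ℝ → DiscreteDobrushin) (hE' : ZdDiscretisationFamily D' E')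
    (f : BoundedContinuousFunction (CurveClass ℂ) ℝ) (δs : ℕ → ℝ) (hpos : ∀ n, 0 < δs n)
    (hlim : Tendsto δs atTop (𝓝 0))
    (h : ∀ φ : ℕ → ℕ, StrictMono φ →
      ¬ Tendsto (fun n =>
          (∫ ω, f (bondInterfaceIn D (E (δs (φ n))) ω) ∂(bondPercolation (zdGraph 2) half)) -
            ∫ ω, f (bondInterfaceIn D' (E' (δs (φ n))) ω) ∂(bondPercolation (zdGraph 2) half))
        atTop (𝓝 0)) :
    ¬ LagHandOff := by
  intro hL
  obtain ⟨φ, hφ, P, hPax, -, hconv⟩ := (hL hR hS).2 δs hpos hlim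
  have h1' := hconv D E hE f
  have h2' := hconv D' E' hE' f
  rw [eq_of_isLocal_of_carrier_eq hPax.isLocal hc h0 h1] at h2'
  have h12 := h1'.sub h2'
  rw [sub_self] at h12
  exact h φ hφ h12
end Summit.CriticalPhenomena.CardyFormulaZ2.Theorems.LagHandOff.Negative

end
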